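import Mathlib

/-!
# Venture HSemireg — the sign-free wedge model: monomial basis, structure constants, parity, block spans

HONEST FRAMING. Part of the Lean index of the computation cell `pub-hsemireg` (seat p3; Sunday enclosure of the
FORMULA-N kernel assets of seats th-7 / th-6, ENCLOSURE-PLAN-p3.md).  Finite-dimensional exterior algebra over a field ONLY:
no variety, no cohomology theory, no semiregularity map is constructed here; nothing here says that HC / HC_CM / HC_AV holds;
no Literature fact is declared or used.  The geometric DICTIONARY (why these ranks are the `HT`-side box ranks of the cell's
STRUCTURE.md §1 / theory/FORMULA-N.md) lives in theory/FORMULA-N-th7.md PART B §A.3 / §N and is NOT asserted in Lean.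

THE SIGN-FREE WEDGE MODEL (th-7, theory/th7/KunnethRank.lean v3 4984f5d2bfe5d0eb l.19–205 + HankelRank.lean v1 3e9043874d57f0b1
extras), shared infrastructure of the Künneth (`WedgeKunneth.lean`) and Hankel (`WedgeHankel*.lean`) laws: generators indexed by a
finite linear order `I`, `HT := ⋀(I → K)` with Mathlib's monomial basis `B := (Pi.basisFun K I).ExteriorAlgebra` (indexed by
`Finset I`); the structure constant `u s t` of `E_s ∧ E_t` (a UNIT iff `s ∩ t = ∅`, else `0` — its VALUE is never used); graded
commutativity `E_t ∧ E_s = (-1)^{|t||s|} E_s ∧ E_t` from `ExteriorAlgebra.ι_add_mul_swap` by list induction; the block spans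
`Alg D` / `Hom D d` (monomials supported on `D` / of degree `d`), coordinate support, closure under products.  Statements and proofs
are th-7's, unchanged; only the namespace (`HSemiregKunneth`/`HSemiregHankel` ↦ `Summit.Ventures.HSemireg.Wedge`) and docstrings differ.
-/

open Module Set Set.powersetCard

namespace Summit.Ventures.HSemireg.Wedge

variable (K : Type*) [Field K] (I : Type*) [LinearOrder I] [Fintype I]

/-- the exterior algebra on the generators `I`. -/
abbrev HT : Type _ := ExteriorAlgebra K (I → K)

/-- standard basis of the generators. -/
noncomputable def b : Basis I K (I → K) := Pi.basisFun K I

/-- monomial basis. -/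
noncomputable def B : Basis (Finset I) K (HT K I) := (b K I).ExteriorAlgebra

/-- the exterior algebra on finitely many generators is finite-dimensional (it has the finite monomial basis `B`). -/
instance : Module.Finite K (HT K I) := Module.Finite.of_basis (B K I)

variable {I}

/-- a Finset as an element of `powersetCard` of its own cardinality. -/
def pc (s : Finset I) : powersetCard I s.card := ⟨s, by rw [mem_iff]⟩

omit [LinearOrder I] [Fintype I] in
/-- coercion of `pc s` back to a Finset is `s`. -/
@[simp] lemma coe_pc (s : Finset I) : ((pc s : powersetCard I s.card) : Finset I) = s := rfl

/-- unfolding of the monomial basis `B` as Mathlib's `Basis.ExteriorAlgebra`. -/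
lemma B_apply (s : Finset I) : B K I s = (b K I).ExteriorAlgebra s := rfl

/-! ### Structure constants (units or zero; their values are never used) -/

/-- the structure constant of `E_s ∧ E_t` (a unit if `s ∩ t = ∅`, else `0`). -/
noncomputable def u (s t : Finset I) : K :=
  if h : Disjoint s t then (((permOfDisjoint (s := pc s) (t := pc t) h).sign : ℤ) : K) else 0

omit [Fintype I] in
/-- the structure constant `u s t` is non-zero iff the supports `s`, `t` are disjoint. -/
lemma u_ne_zero_iff {s t : Finset I} : u K s t ≠ 0 ↔ Disjoint s t := by
  have hu : ∀ x : ℤˣ, ((x : ℤ) : K) ≠ 0 := fun x hx => by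
    have h2 : ((x : ℤ) : K) * ((x : ℤ) : K) = 1 := by
      rw [← Int.cast_mul, ← Units.val_mul, Int.units_mul_self, Units.val_one, Int.cast_one]
    rw [hx, mul_zero] at h2
    exact zero_ne_one h2
  unfold u
  split_ifs with h
  · exact ⟨fun _ => h, fun _ => hu _⟩
  · simp [h]

omit [Fintype I] in
/-- the structure constant of two overlapping monomials vanishes. -/
lemma u_eq_zero {s t : Finset I} (h : ¬ Disjoint s t) : u K s t = 0 := by
  rw [u, dif_neg h]

/-- product of two monomials. -/
lemma B_mul_B (s t : Finset I) : B K I s * B K I t = u K s t • B K I (s ∪ t) := by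
  by_cases h : Disjoint s t
  · have h1 := ExteriorAlgebra.basis_mul_of_disjoint (b K I) (pc s) (pc t) h
    rw [coe_disjUnion, Finset.disjUnion_eq_union] at h1
    change B K I s * B K I t = _ at h1
    rw [h1, u, dif_pos h, Units.smul_def, ← Int.cast_smul_eq_zsmul K]
    rfl
  · have h1 := ExteriorAlgebra.basis_mul_of_not_disjoint (b K I) (pc s) (pc t) h
    change B K I s * B K I t = 0 at h1
    rw [h1, u_eq_zero K h, zero_smul]

/-! ### Graded commutativity (parity only) -/

omit [LinearOrder I] [Fintype I] in
/-- moving one generator past a product of `l.length` generators costs the sign `(-1)^{l.length}`. -/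
lemma ι_mul_ιprod (x : I → K) (l : List (I → K)) :
    ExteriorAlgebra.ι K x * (l.map (ExteriorAlgebra.ι K)).prod =
      ((-1 : K) ^ l.length) • ((l.map (ExteriorAlgebra.ι K)).prod * ExteriorAlgebra.ι K x) := by
  induction l with
  | nil => simp
  | cons y l ih =>
    have hxy : ExteriorAlgebra.ι K x * ExteriorAlgebra.ι K y =
        -(ExteriorAlgebra.ι K y * ExteriorAlgebra.ι K x) :=
      eq_neg_of_add_eq_zero_left (ExteriorAlgebra.ι_add_mul_swap x y)
    rw [List.map_cons, List.prod_cons, List.length_cons, ← mul_assoc, hxy, neg_mul, mul_assoc, ih,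
      mul_smul_comm, pow_succ, mul_neg_one, neg_smul, mul_assoc]

omit [LinearOrder I] [Fintype I] in
/-- graded commutativity for products of generators: sign `(-1)^{|l₁|·|l₂|}`. -/
lemma ιprod_mul_ιprod (l₁ l₂ : List (I → K)) :
    (l₁.map (ExteriorAlgebra.ι K)).prod * (l₂.map (ExteriorAlgebra.ι K)).prod =
      ((-1 : K) ^ (l₁.length * l₂.length)) •
        ((l₂.map (ExteriorAlgebra.ι K)).prod * (l₁.map (ExteriorAlgebra.ι K)).prod) := by
  induction l₁ with
  | nil => simp
  | cons x l₁ ih =>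
    rw [List.map_cons, List.prod_cons, List.length_cons, mul_assoc, ih, mul_smul_comm, ← mul_assoc,
      ι_mul_ιprod, smul_mul_assoc, smul_smul, add_mul, one_mul, pow_add, mul_assoc]

/-- a monomial `B s` is the ordered product of the generators indexed by `s`. -/
lemma B_eq_ιprod (s : Finset I) :
    B K I s = ((List.ofFn ((b K I) ∘ (ofFinEmbEquiv.symm (pc s)))).map (ExteriorAlgebra.ι K)).prod := by
  rw [B_apply, show s = ((pc s : powersetCard I s.card) : Finset I) from rfl,
    ExteriorAlgebra.basis_apply_powersetCard, List.map_ofFn]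
  rfl

/-- graded commutativity of monomials: `E_t ∧ E_s = (−1)^{|t||s|} E_s ∧ E_t`. -/
lemma B_mul_B_comm (s t : Finset I) :
    B K I t * B K I s = ((-1 : K) ^ (t.card * s.card)) • (B K I s * B K I t) := by
  rw [B_eq_ιprod K s, B_eq_ιprod K t, ιprod_mul_ιprod, List.length_ofFn, List.length_ofFn]

/-! ### Supported / homogeneous spans -/

variable (I)

/-- the span of the monomials supported on `D` («the sub-exterior-algebra of the block `D`»). -/
noncomputable def Alg (D : Finset I) : Submodule K (HT K I) :=
  Submodule.span K ((fun s => B K I s) '' {s | s ⊆ D})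

/-- the span of the degree-`d` monomials supported on `D`. -/
noncomputable def Hom (D : Finset I) (d : ℕ) : Submodule K (HT K I) :=
  Submodule.span K ((fun s => B K I s) '' {s | s ⊆ D ∧ s.card = d})

variable {I}

/-- `Hom D d ≤ Alg D`: degree-`d` monomials on `D` are monomials on `D`. -/
lemma Hom_le_Alg (D : Finset I) (d : ℕ) : Hom K I D d ≤ Alg K I D := by
  apply Submodule.span_mono
  rintro _ ⟨s, hs, rfl⟩
  exact ⟨s, hs.1, rfl⟩

/-- a monomial supported on `D` lies in `Alg D`. -/
lemma B_mem_Alg {D s : Finset I} (hs : s ⊆ D) : B K I s ∈ Alg K I D :=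
  Submodule.subset_span ⟨s, hs, rfl⟩

/-- a monomial supported on `D` of cardinality `d` lies in `Hom D d`. -/
lemma B_mem_Hom {D s : Finset I} {d : ℕ} (hs : s ⊆ D) (hc : s.card = d) : B K I s ∈ Hom K I D d :=
  Submodule.subset_span ⟨s, ⟨hs, hc⟩, rfl⟩

/-- coordinates of an element of `Alg D` are supported on subsets of `D`. -/
lemma coord_eq_zero_of_mem_Alg {D : Finset I} {w : HT K I} (hw : w ∈ Alg K I D) {t : Finset I}
    (ht : ¬ t ⊆ D) : (B K I).coord t w = 0 := by
  classical
  induction hw using Submodule.span_induction with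
  | mem x hx =>
    obtain ⟨s, hs, rfl⟩ := hx
    rw [Basis.coord_apply, Basis.repr_self, Finsupp.single_apply, if_neg]
    rintro rfl; exact ht hs
  | zero => simp
  | add x y _ _ hx hy => rw [map_add, hx, hy, add_zero]
  | smul a x _ hx => rw [map_smul, hx, smul_zero]

/-- coordinates of an element of `Hom D d` are supported on subsets of `D` of cardinality `d`. -/
lemma coord_eq_zero_of_mem_Hom {D : Finset I} {d : ℕ} {w : HT K I} (hw : w ∈ Hom K I D d) {t : Finset I}
    (ht : ¬ (t ⊆ D ∧ t.card = d)) : (B K I).coord t w = 0 := by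
  classical
  induction hw using Submodule.span_induction with
  | mem x hx =>
    obtain ⟨s, hs, rfl⟩ := hx
    rw [Basis.coord_apply, Basis.repr_self, Finsupp.single_apply, if_neg]
    rintro rfl; exact ht hs
  | zero => simp
  | add x y _ _ hx hy => rw [map_add, hx, hy, add_zero]
  | smul a x _ hx => rw [map_smul, hx, smul_zero]

/-- an element of `Alg D` all of whose `D`-coordinates vanish is zero. -/
lemma eq_zero_of_coord_eq_zero {D : Finset I} {w : HT K I} (hw : w ∈ Alg K I D)
    (h : ∀ s, s ⊆ D → (B K I).coord s w = 0) : w = 0 := by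
  apply (B K I).repr.injective
  rw [map_zero]
  ext t
  by_cases ht : t ⊆ D
  · exact h t ht
  · exact coord_eq_zero_of_mem_Alg K hw ht

/-- a monomial commutes past a homogeneous element up to parity. -/
lemma B_mul_comm_of_mem_Hom {D : Finset I} {d : ℕ} {f : HT K I} (hf : f ∈ Hom K I D d) (t : Finset I) :
    B K I t * f = ((-1 : K) ^ (t.card * d)) • (f * B K I t) := by
  induction hf using Submodule.span_induction with
  | mem x hx =>
    obtain ⟨s, hs, rfl⟩ := hx
    rw [B_mul_B_comm, hs.2]
  | zero => simp
  | add x y _ _ hx hy => rw [mul_add, add_mul, hx, hy, smul_add]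
  | smul a x _ hx => rw [mul_smul_comm, smul_mul_assoc, hx, smul_comm]

/-- `E_s ∧ (Hom D d) ⊆ Hom D (|s| + d)` for `s ⊆ D`. -/
lemma B_mul_mem_Hom {D s : Finset I} {d : ℕ} {f : HT K I} (hs : s ⊆ D) (hf : f ∈ Hom K I D d) :
    B K I s * f ∈ Hom K I D (s.card + d) := by
  induction hf using Submodule.span_induction with
  | mem x hx =>
    obtain ⟨t, ht, rfl⟩ := hx
    rw [B_mul_B]
    by_cases hst : Disjoint s t
    · exact Submodule.smul_mem _ _ (B_mem_Hom K (Finset.union_subset hs ht.1)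
        (by rw [Finset.card_union_of_disjoint hst, ht.2]))
    · rw [u_eq_zero K hst, zero_smul]; exact Submodule.zero_mem _
  | zero => rw [mul_zero]; exact Submodule.zero_mem _
  | add x y _ _ hx hy => rw [mul_add]; exact Submodule.add_mem _ hx hy
  | smul a x _ hx => rw [mul_smul_comm]; exact Submodule.smul_mem _ _ hx

/-- `Hom` is monotone in the block `D`. -/
lemma Hom_mono {D D' : Finset I} (h : D ⊆ D') (d : ℕ) : Hom K I D d ≤ Hom K I D' d := by
  apply Submodule.span_mono
  rintro _ ⟨s, hs, rfl⟩
  exact ⟨s, ⟨hs.1.trans h, hs.2⟩, rfl⟩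

/-- `(Hom D d) ∧ E_s ⊆ Hom D' (d + |s|)` for `D ∪ s ⊆ D'`. -/
lemma mul_B_mem_Hom {D D' s : Finset I} {d : ℕ} {f : HT K I} (hD : D ⊆ D') (hs : s ⊆ D')
    (hf : f ∈ Hom K I D d) : f * B K I s ∈ Hom K I D' (d + s.card) := by
  induction hf using Submodule.span_induction with
  | mem x hx =>
    obtain ⟨t, ht, rfl⟩ := hx
    rw [B_mul_B]
    by_cases hst : Disjoint t s
    · exact Submodule.smul_mem _ _ (B_mem_Hom K (Finset.union_subset (ht.1.trans hD) hs)
        (by rw [Finset.card_union_of_disjoint hst, ht.2]))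
    · rw [u_eq_zero K hst, zero_smul]; exact Submodule.zero_mem _
  | zero => rw [zero_mul]; exact Submodule.zero_mem _
  | add x y _ _ hx hy => rw [add_mul]; exact Submodule.add_mem _ hx hy
  | smul a x _ hx => rw [smul_mul_assoc]; exact Submodule.smul_mem _ _ hx

/-- `Alg D` is closed under products. -/
lemma mul_mem_Alg {D : Finset I} {v w : HT K I} (hv : v ∈ Alg K I D) (hw : w ∈ Alg K I D) :
    v * w ∈ Alg K I D := by
  induction hv, hw using Submodule.span_induction₂ with
  | mem_mem x y hx hy =>
    obtain ⟨a, ha, rfl⟩ := hx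
    obtain ⟨c, hc, rfl⟩ := hy
    rw [B_mul_B]
    exact Submodule.smul_mem _ _ (B_mem_Alg K (Finset.union_subset ha hc))
  | zero_left y _ => rw [zero_mul]; exact Submodule.zero_mem _
  | zero_right x _ => rw [mul_zero]; exact Submodule.zero_mem _
  | add_left x y z _ _ _ hx hy => rw [add_mul]; exact Submodule.add_mem _ hx hy
  | add_right x y z _ _ _ hx hy => rw [mul_add]; exact Submodule.add_mem _ hx hy
  | smul_left r x y _ _ hx => rw [smul_mul_assoc]; exact Submodule.smul_mem _ _ hx
  | smul_right r x y _ _ hx => rw [mul_smul_comm]; exact Submodule.smul_mem _ _ hx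

end Summit.Ventures.HSemireg.Wedge
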